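import Mathlib
import HarnessLib
import Summits.HubbardSuperconductivity.HubbardSuperconductivity.Theorems.KLProgrammeKLRegimeVolumeLimitTorusPeriodisation

/-!
# Nested tori: the `ℓ¹` distance «coarse kernel vs PERIODISED fine kernel» splits into the PINNED difference on the centred lifts and the fine
# kernel's FAR TAIL (cell gate-hubbard-kl, seat hubbard-kl-k3c4-p1 g6, technique «FST2 volume lemmas»; `--supports` the VL item)

The position-space door of the VL carrier (k3c5-p3's `carrierRateText_of_sitePeriodisation`, p498426/p501111) asks for
(S) `Σ_{x̄} ‖h x̄ − Σ_{red y = x̄} g y‖ ≤ ρ(L)` — the site kernel `h` of the coarse torus `(ℤ/m)^d` against the PERIODISATION of the site kernel `g` of the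
fine torus `(ℤ/M)^d`, `M = b·m`.  The mechanisms that produce the nested comparison (β′ semigroup defect on one algebra, k3c5-p2; α periodisation,
this seat) deliver instead the PINNED difference `h x̄ − g (clift x̄)` at the CENTRED LIFT `clift x̄ := Torus.proj M (Torus.cRep x̄)` (the fine site with the
same centred representative).  This module is the bookkeeping between the two:

* §1 the centred lift is a section of the reduction (`reduce_clift`), and every fine site of torus sup-distance `≤ T`, `2T < m`, IS the centred lift of its
  reduction (`clift_reduce_of_tnorm_le`); hence a fine site that is NOT a centred lift is FAR: `(m − 1)/2 + 1 ≤ Torus.tnorm y` (`le_tnorm_of_ne_clift`);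
* §2 **the split** (`sum_norm_sub_periodise_le_pinned_add_far`):
  `Σ_{x̄} ‖h x̄ − Σ_{red y = x̄} g y‖ ≤ Σ_{x̄} ‖h x̄ − g (clift x̄)‖ + Σ_{y ≠ clift (red y)} ‖g y‖`;
* §3 the far tail under any monotone non-negative weight (`sum_far_norm_le_of_weighted`): `Σ_{y ≠ clift (red y)} ‖g y‖ ≤ N / w((m−1)/2+1)` whenever
  `Σ_y w(tnorm y)‖g y‖ ≤ N`; combined form `sum_norm_sub_periodise_le_pinned_add_weighted`;
* §4 (appended) the same in the currency of the door's first centred site moment (hD) `Σ_z (Σ_i |cRepZ (z i)|)·‖g z‖ ≤ D`: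
  `sum_far_norm_le_of_firstMoment` (tail `≤ D/((m−1)/2+1)`) and `sum_norm_sub_periodise_le_pinned_add_firstMoment`.

Everything is proved; no definition (the lift and the reduction are written inline); nothing is asserted about the model.
-/

noncomputable section

namespace Summit.HubbardSuperconductivity.HubbardSuperconductivity.Theorems.TwoPointAssembly

set_option linter.dupNamespace false -- summit = problem name (single-conjunct summit), D-0017

open Finset Complex Literature.MathematicalPhysics.QuantumLattice Literature.Probability.LatticeModels

section Nested

variable {d b m M : ℕ} [NeZero M] [NeZero m]

/-! ## §1 The centred lift is a section of the reduction; near points are centred lifts -/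

omit [NeZero m] in
/-- The reduction is `proj m ∘ cRep`: `(y_i.val : ℤ/m) = (cRepZ y_i : ℤ/m)` for `m ∣ M`. [folklore] -/
theorem reduce_eq_proj_cRep (hM : M = b * m) (y : TorusSite d M) :
    (fun i => (((y i).val : ℕ) : ZMod m)) = Torus.proj m (Torus.cRep y) := by
  rw [reduce_eq_castHom hM]
  funext i
  rw [Torus.proj_apply, Torus.cRep]
  conv_lhs => rw [← Torus.intCast_cRepZ (y i)]
  rw [map_intCast]

/-- **The centred lift is a section of the reduction**: `red (proj M (cRep x̄)) = x̄`. [folklore] -/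
theorem reduce_clift (hM : M = b * m) (xbar : TorusSite d m) :
    (fun i => ((((Torus.proj M (Torus.cRep xbar)) i).val : ℕ) : ZMod m)) = xbar := by
  rw [reduce_eq_castHom hM]
  funext i
  rw [Torus.proj_apply, Torus.cRep, map_intCast, Torus.intCast_cRepZ]

/-- **Near points are centred lifts**: if `tnorm y ≤ T` with `2T < m` then `y = proj M (cRep (red y))`. [folklore] -/
theorem clift_reduce_of_tnorm_le (hM : M = b * m) {T : ℕ} (hT : 2 * T < m) {y : TorusSite d M} (hy : Torus.tnorm y ≤ T) :
    Torus.proj M (Torus.cRep (fun i => (((y i).val : ℕ) : ZMod m))) = y := by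
  rw [reduce_eq_proj_cRep hM, Torus.cRep_proj_of_mem_box hT (Torus.cRep_mem_box_iff.2 hy), Torus.proj_cRep]

/-- **A fine site that is not a centred lift is far**: `(m − 1)/2 + 1 ≤ tnorm y`. [folklore] -/
theorem le_tnorm_of_ne_clift (hM : M = b * m) {y : TorusSite d M}
    (hy : Torus.proj M (Torus.cRep (fun i => (((y i).val : ℕ) : ZMod m))) ≠ y) : (m - 1) / 2 + 1 ≤ Torus.tnorm y := by
  by_contra h
  have hle : Torus.tnorm y ≤ (m - 1) / 2 := by omega
  have h2 : 2 * ((m - 1) / 2) < m := by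
    have : m ≠ 0 := NeZero.ne m
    omega
  exact hy (clift_reduce_of_tnorm_le hM h2 hle)

/-! ## §2 The split: periodised difference ≤ pinned difference + far tail -/

omit [NeZero m] in
/-- The fibre of `x̄` minus its centred lift is the part of the fibre made of NON-lifts. [folklore] -/
theorem fibre_erase_clift_eq (xbar : TorusSite d m) :
    (univ.filter (fun y : TorusSite d M => (fun i => (((y i).val : ℕ) : ZMod m)) = xbar)).erase (Torus.proj M (Torus.cRep xbar)) =
      (univ.filter (fun y : TorusSite d M => Torus.proj M (Torus.cRep (fun i => (((y i).val : ℕ) : ZMod m))) ≠ y)).filter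
        (fun y : TorusSite d M => (fun i => (((y i).val : ℕ) : ZMod m)) = xbar) := by
  classical
  ext y
  simp only [Finset.mem_erase, Finset.mem_filter, Finset.mem_univ, true_and]
  constructor
  · rintro ⟨hne, hred⟩
    refine ⟨?_, hred⟩
    rw [hred]
    exact fun h => hne h.symm
  · rintro ⟨hne, hred⟩
    refine ⟨?_, hred⟩
    rw [hred] at hne
    exact fun h => hne h.symm

/-- **THE SPLIT**: `Σ_{x̄} ‖h x̄ − Σ_{red y = x̄} g y‖ ≤ Σ_{x̄} ‖h x̄ − g (clift x̄)‖ + Σ_{y ≠ clift (red y)} ‖g y‖`. [folklore] -/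
theorem sum_norm_sub_periodise_le_pinned_add_far (hM : M = b * m) (h : TorusSite d m → ℂ) (g : TorusSite d M → ℂ) :
    ∑ xbar : TorusSite d m, ‖h xbar - ∑ y ∈ univ.filter (fun y : TorusSite d M => (fun i => (((y i).val : ℕ) : ZMod m)) = xbar), g y‖ ≤
      (∑ xbar : TorusSite d m, ‖h xbar - g (Torus.proj M (Torus.cRep xbar))‖) +
        ∑ y ∈ univ.filter (fun y : TorusSite d M => Torus.proj M (Torus.cRep (fun i => (((y i).val : ℕ) : ZMod m))) ≠ y), ‖g y‖ := by
  classical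
  -- regroup the far tail fibrewise
  have hfar : ∑ y ∈ univ.filter (fun y : TorusSite d M => Torus.proj M (Torus.cRep (fun i => (((y i).val : ℕ) : ZMod m))) ≠ y), ‖g y‖ =
      ∑ xbar : TorusSite d m, ∑ y ∈ (univ.filter (fun y : TorusSite d M =>
        (fun i => (((y i).val : ℕ) : ZMod m)) = xbar)).erase (Torus.proj M (Torus.cRep xbar)), ‖g y‖ := by
    rw [← Finset.sum_fiberwise (univ.filter (fun y : TorusSite d M =>
      Torus.proj M (Torus.cRep (fun i => (((y i).val : ℕ) : ZMod m))) ≠ y)) (fun y : TorusSite d M => (fun i => (((y i).val : ℕ) : ZMod m)))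
      (fun y => ‖g y‖)]
    refine Finset.sum_congr rfl fun xbar _ => ?_
    rw [fibre_erase_clift_eq xbar]
  rw [hfar, ← Finset.sum_add_distrib]
  refine Finset.sum_le_sum fun xbar _ => ?_
  have hmem : Torus.proj M (Torus.cRep xbar) ∈
      univ.filter (fun y : TorusSite d M => (fun i => (((y i).val : ℕ) : ZMod m)) = xbar) :=
    Finset.mem_filter.2 ⟨Finset.mem_univ _, reduce_clift hM xbar⟩
  rw [← Finset.add_sum_erase _ _ hmem, ← sub_sub]
  exact (norm_sub_le _ _).trans (add_le_add le_rfl (norm_sum_le _ _))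

/-! ## §3 The far tail under a monotone decay weight -/

/-- **The far tail is one weighted norm away**: `Σ_{y ≠ clift (red y)} ‖g y‖ ≤ N / w((m−1)/2+1)` whenever `Σ_y w(tnorm y)·‖g y‖ ≤ N`, for any monotone
non-negative weight with `0 < w((m−1)/2+1)`. [folklore] -/
theorem sum_far_norm_le_of_weighted (hM : M = b * m) (g : TorusSite d M → ℂ) {w : ℕ → ℝ} (hw : Monotone w) (hw0 : ∀ k, 0 ≤ w k)
    (hwm : 0 < w ((m - 1) / 2 + 1)) {N : ℝ} (hN : ∑ y : TorusSite d M, w (Torus.tnorm y) * ‖g y‖ ≤ N) :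
    ∑ y ∈ univ.filter (fun y : TorusSite d M => Torus.proj M (Torus.cRep (fun i => (((y i).val : ℕ) : ZMod m))) ≠ y), ‖g y‖ ≤
      N / w ((m - 1) / 2 + 1) := by
  classical
  rw [le_div_iff₀ hwm, Finset.sum_mul]
  calc ∑ y ∈ univ.filter (fun y : TorusSite d M => Torus.proj M (Torus.cRep (fun i => (((y i).val : ℕ) : ZMod m))) ≠ y), ‖g y‖ * w ((m - 1) / 2 + 1)
      ≤ ∑ y ∈ univ.filter (fun y : TorusSite d M => Torus.proj M (Torus.cRep (fun i => (((y i).val : ℕ) : ZMod m))) ≠ y),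
          w (Torus.tnorm y) * ‖g y‖ := by
        refine Finset.sum_le_sum fun y hy => ?_
        rw [mul_comm]
        exact mul_le_mul_of_nonneg_right (hw (le_tnorm_of_ne_clift hM (Finset.mem_filter.1 hy).2)) (norm_nonneg _)
    _ ≤ ∑ y : TorusSite d M, w (Torus.tnorm y) * ‖g y‖ :=
        Finset.sum_le_sum_of_subset_of_nonneg (fun y _ => Finset.mem_univ y) fun y _ _ => mul_nonneg (hw0 _) (norm_nonneg _)
    _ ≤ N := hN

/-- **(S) from the pinned difference and a weighted norm**:
`Σ_{x̄} ‖h x̄ − Σ_{red y = x̄} g y‖ ≤ Σ_{x̄} ‖h x̄ − g (clift x̄)‖ + N / w((m−1)/2+1)`. [folklore] -/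
theorem sum_norm_sub_periodise_le_pinned_add_weighted (hM : M = b * m) (h : TorusSite d m → ℂ) (g : TorusSite d M → ℂ) {w : ℕ → ℝ}
    (hw : Monotone w) (hw0 : ∀ k, 0 ≤ w k) (hwm : 0 < w ((m - 1) / 2 + 1)) {N : ℝ}
    (hN : ∑ y : TorusSite d M, w (Torus.tnorm y) * ‖g y‖ ≤ N) :
    ∑ xbar : TorusSite d m, ‖h xbar - ∑ y ∈ univ.filter (fun y : TorusSite d M => (fun i => (((y i).val : ℕ) : ZMod m)) = xbar), g y‖ ≤
      (∑ xbar : TorusSite d m, ‖h xbar - g (Torus.proj M (Torus.cRep xbar))‖) + N / w ((m - 1) / 2 + 1) :=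
  (sum_norm_sub_periodise_le_pinned_add_far hM h g).trans (add_le_add le_rfl (sum_far_norm_le_of_weighted hM g hw hw0 hwm hN))


/-! ## §4 The far tail in the currency of the VL door's first moment `Σ_z (Σ_i |cRepZ (z i)|)·‖g z‖` (k3c5-p3's (hD)) -/

omit [NeZero M] [NeZero m] in
/-- `tnorm z ≤ Σ_i |cRepZ (z i)|` (sup ≤ sum of non-negative terms), in `ℝ`. [folklore] -/
theorem tnorm_le_sum_abs_cRepZ (z : TorusSite d M) : (Torus.tnorm z : ℝ) ≤ ∑ i, |(Torus.cRepZ (z i) : ℝ)| := by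
  have hnat : Torus.tnorm z ≤ ∑ i, (Torus.cRepZ (z i)).natAbs := by
    unfold Torus.tnorm Site.supNorm
    refine Finset.sup_le fun i _ => ?_
    exact Finset.single_le_sum (f := fun j => (Torus.cRep z j).natAbs) (fun j _ => Nat.zero_le _) (Finset.mem_univ i)
  have hcast : ((∑ i, (Torus.cRepZ (z i)).natAbs : ℕ) : ℝ) = ∑ i, |(Torus.cRepZ (z i) : ℝ)| := by
    push_cast
    refine Finset.sum_congr rfl fun i _ => ?_
    rw [Nat.cast_natAbs, Int.cast_abs]
  exact_mod_cast hcast ▸ (show ((Torus.tnorm z : ℕ) : ℝ) ≤ ((∑ i, (Torus.cRepZ (z i)).natAbs : ℕ) : ℝ) by exact_mod_cast hnat)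

/-- **The far tail from the first centred site moment**: `Σ_{y ≠ clift (red y)} ‖g y‖ ≤ (Σ_z (Σ_i |cRepZ (z i)|)·‖g z‖) / ((m−1)/2+1)` — rate `≈ 2D/m`
from the door's own (hD) majorant `D`. [folklore] -/
theorem sum_far_norm_le_of_firstMoment (hM : M = b * m) (g : TorusSite d M → ℂ) {D : ℝ}
    (hD : ∑ z : TorusSite d M, (∑ i, |(Torus.cRepZ (z i) : ℝ)|) * ‖g z‖ ≤ D) :
    ∑ y ∈ univ.filter (fun y : TorusSite d M => Torus.proj M (Torus.cRep (fun i => (((y i).val : ℕ) : ZMod m))) ≠ y), ‖g y‖ ≤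
      D / (((m - 1) / 2 + 1 : ℕ) : ℝ) := by
  have hw : Monotone (fun k : ℕ => (k : ℝ)) := fun a b h => by
    show (a : ℝ) ≤ (b : ℝ)
    exact_mod_cast h
  have hN : ∑ y : TorusSite d M, ((Torus.tnorm y : ℕ) : ℝ) * ‖g y‖ ≤ D :=
    (Finset.sum_le_sum fun y _ => mul_le_mul_of_nonneg_right (tnorm_le_sum_abs_cRepZ y) (norm_nonneg _)).trans hD
  have h := sum_far_norm_le_of_weighted hM g hw (fun k => Nat.cast_nonneg k) (by positivity) hN
  simpa using h

/-- **(S) from the pinned difference and the first centred site moment of the fine kernel**: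
`Σ_{x̄} ‖h x̄ − Σ_{red y = x̄} g y‖ ≤ Σ_{x̄} ‖h x̄ − g (clift x̄)‖ + D / ((m−1)/2+1)`. [folklore] -/
theorem sum_norm_sub_periodise_le_pinned_add_firstMoment (hM : M = b * m) (h : TorusSite d m → ℂ) (g : TorusSite d M → ℂ) {D : ℝ}
    (hD : ∑ z : TorusSite d M, (∑ i, |(Torus.cRepZ (z i) : ℝ)|) * ‖g z‖ ≤ D) :
    ∑ xbar : TorusSite d m, ‖h xbar - ∑ y ∈ univ.filter (fun y : TorusSite d M => (fun i => (((y i).val : ℕ) : ZMod m)) = xbar), g y‖ ≤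
      (∑ xbar : TorusSite d m, ‖h xbar - g (Torus.proj M (Torus.cRep xbar))‖) + D / (((m - 1) / 2 + 1 : ℕ) : ℝ) :=
  (sum_norm_sub_periodise_le_pinned_add_far hM h g).trans (add_le_add le_rfl (sum_far_norm_le_of_firstMoment hM g hD))

end Nested

end Summit.HubbardSuperconductivity.HubbardSuperconductivity.Theorems.TwoPointAssembly

end
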